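import Literature.AnabelianGeometry.SemiGraphs.TemperedCompletionExtension
import Mathlib.Topology.Algebra.Category.ProfiniteGrp.Basic
import Mathlib.Topology.Algebra.ClopenNhdofOne
import HarnessLib

/-!
# Profinite completions EXIST, are unique, and are injective iff the group is residually finite
# (for the open finite-index normal subgroups) — the interface `IsProfiniteCompletion` is inhabited

Mochizuki, *Semi-graphs of anabelioids*, Publ. RIMS **42** (2006) [SemiAnbd], §6 p. 69: "we shall denote
the profinite completion of a group by means of a `∧`"; p. 69 "natural injection `Π^temp_{X_K} ↪ Π_{X_K}`
[residual finiteness]". [cite: MochizukiSemiAnbd2006, §6 p.69]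

PROOF-ONLY companion of `TemperedAnabelian.lean` (abc-iut cell, prover abc-iut-L2-d1 gen 4; Mathlib +
the interface file + `TemperedCompletionExtension.lean` only; no definition, no named fact).  The tree
records profinite completions as INTERFACE DATA (`TemperedCurve.PiHat/toHat/isProfiniteCompletion_toHat`,
`ThetaCovers.TemperedCoverData.toHat/isProfiniteCompletion_toHat`, the `hPC : IsProfiniteCompletion …`
binders of the [IUTchI] §2 chain, …) against abc-iut-L3-t2's predicate
`SemiGraphs.IsProfiniteCompletion ι` (compact Hausdorff totally disconnected target, dense range, every
open normal subgroup of finite index of the source is a pull-back, pull-backs of open normal subgroups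
are open).  This file supplies the three classical facts that justify that convention:

* `IsProfiniteCompletion.exists_isProfiniteCompletion` — **EXISTENCE**: every topological group `F`
  admits a profinite completion `ι : F → F̂` with `IsProfiniteCompletion ι` (`F̂ :=` the closure of the
  image of `F` in `∏_U F/U`, `U` ranging over the open normal subgroups of finite index; Ribes–Zalesskii,
  *Profinite Groups*, §3.2);
* `IsProfiniteCompletion.nonempty_continuousMulEquiv` — **UNIQUENESS**: any two profinite completions of
  `F` are isomorphic over `F` (universal property, `exists_extension` / `extension_unique`);
* `IsProfiniteCompletion.injective_iff` — **INJECTIVITY CRITERION**: `ι` is injective iff the open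
  normal subgroups of finite index of `F` separate points ("residual finiteness", the content of the
  printed "natural injection").

HONEST FRAMING: classical profinite group theory; nothing of [SemiAnbd] §6 beyond the definition is
asserted; no side is taken on [IUTchIII] Cor. 3.12.
-/

noncomputable section

namespace Literature.AnabelianGeometry.SemiGraphs

namespace IsProfiniteCompletion

open Topology

universe u v w

/-! ### Existence -/

/-- **Existence of the profinite completion** ([SemiAnbd] §6 p. 69 "the profinite completion of a
group"; Ribes–Zalesskii §3.2): for every topological group `F` there is a profinite group `F̂` and a
continuous homomorphism `ι : F → F̂` satisfying `IsProfiniteCompletion ι` — namely the closure of the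
image of `g ↦ (g mod U)_U` in `∏_U F/U`, `U` running over the open normal subgroups of finite index of
`F` (each `F/U` finite discrete). [cite: MochizukiSemiAnbd2006, §6 p.69] -/
theorem exists_isProfiniteCompletion (F : Type u) [Group F] [TopologicalSpace F] [IsTopologicalGroup F] :
    ∃ (P : ProfiniteGrp.{u}) (ι : F →ₜ* P), IsProfiniteCompletion ι := by
  classical
  -- the index set and the finite discrete quotients
  let J : Type u := {U : OpenNormalSubgroup F // U.toSubgroup.FiniteIndex}
  let Q : J → Type u := fun j => F ⧸ j.1.toSubgroup
  haveI hdisc : ∀ j : J, DiscreteTopology (Q j) := fun j => QuotientGroup.discreteTopology j.1.isOpen'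
  haveI hfin : ∀ j : J, Finite (Q j) := fun j => by
    haveI : j.1.toSubgroup.FiniteIndex := j.2
    exact Subgroup.finite_quotient_of_finiteIndex
  -- the diagonal map into the product
  let φ : F →* ((j : J) → Q j) := MonoidHom.pi fun j => QuotientGroup.mk' j.1.toSubgroup
  have hφc : Continuous φ := continuous_pi fun j => QuotientGroup.continuous_mk
  have hφ_apply : ∀ (g : F) (j : J), φ g j = (QuotientGroup.mk g : Q j) := fun g j => rfl
  -- the completion: the closure of the image
  let P : Subgroup ((j : J) → Q j) := φ.range.topologicalClosure
  have hPclosed : IsClosed (P : Set ((j : J) → Q j)) := Subgroup.isClosed_topologicalClosure _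
  haveI : CompactSpace P := isCompact_iff_compactSpace.mp hPclosed.isCompact
  let ι : F →ₜ* P :=
    { toMonoidHom := φ.codRestrict P fun g => Subgroup.le_topologicalClosure _ ⟨g, rfl⟩
      continuous_toFun := hφc.subtype_mk _ }
  have hι_val : ∀ g : F, ((ι g : P) : (j : J) → Q j) = φ g := fun g => rfl
  refine ⟨ProfiniteGrp.of P, ι, ?_⟩
  refine ⟨inferInstance, inferInstance, inferInstance, ?_, ?_, ?_⟩
  · -- dense range
    intro x
    rw [IsEmbedding.subtypeVal.closure_eq_preimage_closure_image, Set.mem_preimage]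
    have himg : Subtype.val '' Set.range ι = Set.range φ := by
      ext y
      constructor
      · rintro ⟨_, ⟨g, rfl⟩, rfl⟩
        exact ⟨g, rfl⟩
      · rintro ⟨g, rfl⟩
        exact ⟨ι g, ⟨g, rfl⟩, rfl⟩
    rw [himg]
    have hx : (x : (j : J) → Q j) ∈ (P : Set ((j : J) → Q j)) := x.2
    rwa [Subgroup.topologicalClosure_coe, MonoidHom.coe_range] at hx
  · -- every open normal subgroup of finite index is a pull-back
    intro U hU
    let j₀ : J := ⟨U, hU⟩
    let π : P →* Q j₀ := (Pi.evalMonoidHom Q j₀).comp P.subtype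
    have hπc : Continuous π := (continuous_apply j₀).comp continuous_subtype_val
    have hker_open : IsOpen (π.ker : Set P) := by
      have : (π.ker : Set P) = π ⁻¹' {1} := by ext x; simp [MonoidHom.mem_ker]
      rw [this]
      exact (isOpen_discrete _).preimage hπc
    refine ⟨{ toSubgroup := π.ker, isOpen' := hker_open, isNormal' := inferInstance }, ?_⟩
    ext g
    change g ∈ U.toSubgroup ↔ ι g ∈ π.ker
    rw [MonoidHom.mem_ker]
    change _ ↔ φ g j₀ = 1
    rw [hφ_apply, QuotientGroup.eq_one_iff]
  · -- pull-backs of open normal subgroups are open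
    intro V
    exact V.isOpen'.preimage ι.continuous

/-! ### Uniqueness -/

/-- **Uniqueness of the profinite completion up to a unique isomorphism over `F`** ([SemiAnbd] §6
p. 69, "THE profinite completion"): any two profinite completions `ι₁ : F → P₁`, `ι₂ : F → P₂` are
related by an isomorphism of topological groups `e : P₁ ≅ P₂` with `e ∘ ι₁ = ι₂` (extend each along
the other by the universal property; the two composites restrict to the identity on the dense images).
[cite: MochizukiSemiAnbd2006, §6 p.69] -/
theorem nonempty_continuousMulEquiv {F : Type u} [Group F] [TopologicalSpace F]
    {P₁ : Type v} [Group P₁] [TopologicalSpace P₁] [IsTopologicalGroup P₁]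
    {P₂ : Type w} [Group P₂] [TopologicalSpace P₂] [IsTopologicalGroup P₂]
    {ι₁ : F →ₜ* P₁} {ι₂ : F →ₜ* P₂} (h₁ : IsProfiniteCompletion ι₁) (h₂ : IsProfiniteCompletion ι₂) :
    ∃ e : P₁ ≃ₜ* P₂, ∀ g : F, e (ι₁ g) = ι₂ g := by
  haveI := h₁.compactSpace; haveI := h₁.t2Space; haveI := h₁.totallyDisconnectedSpace
  haveI := h₂.compactSpace; haveI := h₂.t2Space; haveI := h₂.totallyDisconnectedSpace
  obtain ⟨Φ, hΦ⟩ := h₁.exists_extension ι₂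
  obtain ⟨Ψ, hΨ⟩ := h₂.exists_extension ι₁
  have h12 : Ψ.comp Φ = ContinuousMonoidHom.id P₁ :=
    h₁.extension_unique _ _ fun g => by
      change Ψ (Φ (ι₁ g)) = ι₁ g
      rw [hΦ, hΨ]
  have h21 : Φ.comp Ψ = ContinuousMonoidHom.id P₂ :=
    h₂.extension_unique _ _ fun g => by
      change Φ (Ψ (ι₂ g)) = ι₂ g
      rw [hΨ, hΦ]
  have hl : Function.LeftInverse Ψ Φ := fun x => by
    change (Ψ.comp Φ) x = x
    rw [h12]; rfl
  have hr : Function.RightInverse Ψ Φ := fun y => by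
    change (Φ.comp Ψ) y = y
    rw [h21]; rfl
  exact ⟨ContinuousMulEquiv.mk (MulEquiv.mk ⟨Φ, Ψ, hl, hr⟩ (map_mul Φ)) Φ.continuous Ψ.continuous, hΦ⟩

/-! ### Injectivity ⇔ residual finiteness -/

/-- The pull-back of an open normal subgroup of a compact group under a continuous homomorphism has
finite index. [folklore] -/
private theorem finiteIndex_comap_openNormal' {F : Type u} [Group F] [TopologicalSpace F]
    {P : Type v} [Group P] [TopologicalSpace P] [IsTopologicalGroup P] [CompactSpace P]
    (ψ : F →ₜ* P) (V : OpenNormalSubgroup P) :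
    (V.toSubgroup.comap ψ.toMonoidHom).FiniteIndex := by
  haveI : V.toSubgroup.FiniteIndex := Subgroup.finiteIndex_of_finite_quotient
  haveI : V.toSubgroup.IsFiniteRelIndex ψ.toMonoidHom.range := Subgroup.isFiniteRelIndex_of_finiteIndex
  exact ⟨by rw [Subgroup.index_comap]; exact Subgroup.relIndex_ne_zero⟩

/-- **Injectivity criterion** ([SemiAnbd] §6 p. 69 "natural injection `Π^temp_{X_K} ↪ Π_{X_K}`", from
residual finiteness): a profinite completion `ι : F → F̂` is injective iff the open normal subgroups of
finite index of `F` separate the points of `F` (⇒: pull back an open normal subgroup of `F̂` missing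
`ι g ≠ 1`, which exists as `F̂` is profinite; ⇐: a `g ≠ 1` outside some such `U = ι⁻¹(V)` has
`ι g ∉ V`). [cite: MochizukiSemiAnbd2006, §6 p.69] -/
theorem injective_iff {F : Type u} [Group F] [TopologicalSpace F]
    {P : Type v} [Group P] [TopologicalSpace P] [IsTopologicalGroup P]
    {ι : F →ₜ* P} (h : IsProfiniteCompletion ι) :
    Function.Injective ι ↔
      ∀ g : F, g ≠ 1 → ∃ U : OpenNormalSubgroup F, U.toSubgroup.FiniteIndex ∧ g ∉ U.toSubgroup := by
  haveI := h.compactSpace; haveI := h.t2Space; haveI := h.totallyDisconnectedSpace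
  constructor
  · intro hinj g hg
    have hne : ι g ≠ 1 := fun h1 => hg (hinj (by rw [h1, map_one]))
    obtain ⟨V, hV⟩ := ProfiniteGrp.exist_openNormalSubgroup_sub_open_nhds_of_one
      (isOpen_compl_singleton (x := ι g)) (by simpa using hne.symm)
    let U : OpenNormalSubgroup F :=
      { toOpenSubgroup := V.toOpenSubgroup.comap ι.toMonoidHom ι.continuous
        isNormal' := Subgroup.normal_comap _ }
    refine ⟨U, finiteIndex_comap_openNormal' ι V, ?_⟩
    intro hgV
    exact hV hgV rfl
  · intro hsep
    rw [injective_iff_map_eq_one]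
    intro g hg1
    by_contra hg
    obtain ⟨U, hU, hgU⟩ := hsep g hg
    obtain ⟨V, hUV⟩ := h.comap_surjective U hU
    apply hgU
    rw [hUV, Subgroup.mem_comap]
    change ι g ∈ V.toSubgroup
    rw [hg1]
    exact one_mem _

/-- **The interface is inhabited with an INJECTIVE completion exactly for residually finite `F`**:
combining existence and the criterion, a topological group whose open normal subgroups of finite index
separate points admits a profinite completion `ι : F ↪ F̂` with `IsProfiniteCompletion ι` AND `ι`
injective — the shape of the `TemperedCurve` fields `toHat`, `isProfiniteCompletion_toHat`,
`toHat_injective` ([SemiAnbd] §6 p. 69). [cite: MochizukiSemiAnbd2006, §6 p.69] -/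
theorem exists_isProfiniteCompletion_injective (F : Type u) [Group F] [TopologicalSpace F]
    [IsTopologicalGroup F]
    (hsep : ∀ g : F, g ≠ 1 → ∃ U : OpenNormalSubgroup F, U.toSubgroup.FiniteIndex ∧ g ∉ U.toSubgroup) :
    ∃ (P : ProfiniteGrp.{u}) (ι : F →ₜ* P), IsProfiniteCompletion ι ∧ Function.Injective ι := by
  obtain ⟨P, ι, hι⟩ := exists_isProfiniteCompletion F
  exact ⟨P, ι, hι, hι.injective_iff.mpr hsep⟩

end IsProfiniteCompletion

end Literature.AnabelianGeometry.SemiGraphs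

end
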